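import Literature.Geometry.Riemannian.DistanceLaplacianComparison
import Literature.Geometry.Riemannian.ExpMapThm1034
import Literature.Geometry.Riemannian.LocalIsometryTransport
import Literature.Geometry.Riemannian.RicciNonnegInfiniteVolumeProofs
import Literature.Geometry.Riemannian.CutLocusGeodesic
import HarnessLib

/-!
# The distance function is smooth off the cut locus, and the Laplacian comparison holds there
# classically

Lee 2018, Thm. 10.34 / Prop. 10.32 ff. (the restricted exponential map `exp_q|ID(q)` is a
diffeomorphism onto `M ∖ Cut(q)`) has the classical consequence that `d(q, ·)` is `C^∞` on
`M ∖ ({q} ∪ Cut(q))` (Petersen 2016, §5.7.3; Sakai 1996, Prop. III.4.8): near `x = exp_q w`,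
`w ∈ ID(q) ∖ {0}`, `d(q, ·) = |σ(·)|_{g_q}` for a smooth local inverse `σ` of `exp_q`. We PROVE
this from the tree's `lee_expMap_injectivityDomain_holds` and the inverse function theorem
(`isLocalDiffeomorphAt_of_injective`):

* `edist_expMap_eq_of_mem_injectivityDomain` — `d(q, exp_q w) = |w|_g` for `w ∈ ID(q)`;
* `contMDiffAt_edist_toReal_of_mem_injectivityDomain` — **`d(q, ·)` is `C^∞` at `exp_q w` for
  `w ∈ ID(q)`, `w ≠ 0`**; `contMDiffAt_edist_toReal_of_not_mem_cutLocus` — equivalently, at every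
  `z ∉ {q} ∪ cutLocus q` (`cutLocus_eq_geodesicCutLocus`);
* `laplaceBeltrami_edist_le_coth_of_mem_injectivityDomain` (`Ric ≥ -(m-1) g`),
  `laplaceBeltrami_edist_le_div_of_mem_injectivityDomain` (`Ric ≥ 0`) — **the classical
  (pointwise, smooth) Laplacian comparison `Δ d(q,·) ≤ (m-1) coth d(q,·)`, resp.
  `≤ (m-1)/d(q,·)`, at the points `exp_q(ID(q) ∖ {0})`**, i.e. off `{q} ∪ Cut(q)`: the viscosity
  statement `laplaceBeltrami_le_coth_of_le_edist` of `DistanceLaplacianComparison.lean` applied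
  with the now smooth test function `d(q, ·)` itself (Calabi 1958; Petersen 2016, Lemma 7.1.9).

No definitions, no named facts (D-0026). Groundwork for `CheegerColding1997_sphereStability`
(smooth barriers for distance functions).

## References

* J. M. Lee, *Introduction to Riemannian Manifolds*, 2nd ed. (2018), Thm. 10.34.
  [LeeRiemannianManifolds2018]
* P. Petersen, *Riemannian Geometry*, 3rd ed. (2016), §5.7.3 and Lemma 7.1.9. [Petersen2016]
* E. Calabi, Duke Math. J. 25 (1958) 45–56. [Calabi1958]
-/

noncomputable section

open Bundle Set Function Filter
open scoped Manifold ContDiff Topology ENNReal NNReal Real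

namespace Literature.Geometry.Riemannian

open Lorentzian Lorentzian.PseudoRiemannianMetric

variable {E : Type*} [NormedAddCommGroup E] [NormedSpace ℝ E] [FiniteDimensional ℝ E]
  [CompleteSpace E] {M : Type*} [TopologicalSpace M] [ChartedSpace E M] [IsManifold 𝓘(ℝ, E) ∞ M]
  [T2Space M]
  (g : PseudoRiemannianMetric 𝓘(ℝ, E) ∞ E (TangentSpace 𝓘(ℝ, E) : M → Type _)) [g.HasLeviCivita]
  [CovariantDerivative.ContMDiffCovariantDerivative g.leviCivita 1]

/-- **`d(q, exp_q w) = |w|_g` on the injectivity domain**: `γ_w|[0,1]` is minimizing for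
`w ∈ ID(q)` (`IsMinimizingUpTo.mono`, `isMinimizingUpTo_one_iff`).
[cite: LeeRiemannianManifolds2018, Thm. 10.34] -/
theorem edist_expMap_eq_of_mem_injectivityDomain (hg : g.IsRiemannian)
    (hc : IsGeodesicallyComplete g.leviCivita) (q : M) {w : TangentSpace 𝓘(ℝ, E) q}
    (hw : w ∈ injectivityDomain g hg q) :
    g.edist hg q (expMap g.leviCivita q w) = ENNReal.ofReal (Real.sqrt (g.val q w w)) := by
  haveI : Fact ((1 : ℕ∞ω) ≤ (∞ : ℕ∞ω)) := ⟨by exact_mod_cast le_top⟩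
  obtain ⟨s, hs, hmin⟩ := hw
  have h1 : IsMinimizingUpTo g hg q w 1 := hmin.mono hc zero_le_one hs.le
  obtain ⟨hdom, -, -, -⟩ := maximalGeodesic_of_isGeodesicallyComplete hc q w
  have h := h1.2
  rw [length_maximalGeodesic hg hc q w 0 1, sub_zero, one_mul, ← expMap_eq_maximalGeodesic hc q w] at h
  exact h.symm

/-- **The distance from `q` is smooth at the points `exp_q w`, `w ∈ ID(q) ∖ {0}`** (i.e. on
`M ∖ ({q} ∪ Cut(q))`; Petersen 2016, §5.7.3): `exp_q` is `C^∞` on the open set `ID(q)` with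
injective differential (`lee_expMap_injectivityDomain_holds`), hence a local diffeomorphism at
`w` (`isLocalDiffeomorphAt_of_injective`) with a smooth local inverse `σ`; near `exp_q w`,
`d(q, ·) = |σ(·)|_{g_q}` (`edist_expMap_eq_of_mem_injectivityDomain`), and `|·|_{g_q}` is smooth
away from `0`. [cite: LeeRiemannianManifolds2018, Thm. 10.34] [cite: Petersen2016, §5.7.3] -/
theorem contMDiffAt_edist_toReal_of_mem_injectivityDomain [ConnectedSpace M] (hg : g.IsRiemannian)
    (hc : IsGeodesicallyComplete g.leviCivita) (q : M) {w : TangentSpace 𝓘(ℝ, E) q}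
    (hw : w ∈ injectivityDomain g hg q) (hw0 : w ≠ 0) :
    ContMDiffAt 𝓘(ℝ, E) 𝓘(ℝ, ℝ) ∞ (fun z ↦ (g.edist hg q z).toReal) (expMap g.leviCivita q w) := by
  obtain ⟨-, -, -, hsm, hbij⟩ := lee_expMap_injectivityDomain_holds le_rfl g hg hc q
  have hO := isOpen_injectivityDomain_of_isGeodesicallyComplete g le_rfl hg hc q
  set f : E → M := fun w' ↦ riemannianExpMap g q (show TangentSpace 𝓘(ℝ, E) q from w') with hf
  have hfexp : ∀ w' : E, f w' = expMap g.leviCivita q (show TangentSpace 𝓘(ℝ, E) q from w') :=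
    fun w' ↦ rfl
  have hloc : IsLocalDiffeomorphAt 𝓘(ℝ, E) 𝓘(ℝ, E) ∞ f (show E from w) :=
    isLocalDiffeomorphAt_of_injective hO hw hsm (hbij w hw).1
  set σ := hloc.localInverse with hσ
  have hσw : σ (f w) = w := hloc.localInverse_left_inv hloc.localInverse_mem_target
  have hσs : ContMDiffAt 𝓘(ℝ, E) 𝓘(ℝ, E) ∞ σ (f w) := hloc.localInverse_contMDiffAt
  -- near `exp_q w`: `σ z ∈ ID(q)` and `exp_q (σ z) = z`
  have hσID : ∀ᶠ z in 𝓝 (f w), (show TangentSpace 𝓘(ℝ, E) q from σ z) ∈ injectivityDomain g hg q := by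
    have h := hσs.continuousAt.preimage_mem_nhds (hO.mem_nhds (by rw [hσw]; exact hw))
    exact h
  have hright : ∀ᶠ z in 𝓝 (f w), f (σ z) = z :=
    Filter.eventually_of_mem (hloc.localInverse_open_source.mem_nhds hloc.localInverse_mem_source)
      fun z hz ↦ hloc.localInverse_right_inv hz
  -- so `d(q, z) = |σ z|_g` there
  have hkey : (fun z ↦ (g.edist hg q z).toReal) =ᶠ[𝓝 (f w)]
      fun z ↦ Real.sqrt (g.val q (σ z) (σ z)) := by
    filter_upwards [hσID, hright] with z hzID hz
    have h := edist_expMap_eq_of_mem_injectivityDomain g hg hc q hzID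
    rw [← hfexp, hz] at h
    simp only [h, ENNReal.toReal_ofReal (Real.sqrt_nonneg _)]
  -- smoothness of `z ↦ √(g_q(σ z, σ z))`
  set G : E →L[ℝ] E →L[ℝ] ℝ := g.val q with hG
  have hquad : ContDiff ℝ ∞ fun u : E ↦ G u u :=
    G.isBoundedBilinearMap.contDiff.comp (contDiff_id.prodMk contDiff_id)
  have hpos : G (σ (f w)) (σ (f w)) ≠ 0 := by
    rw [hσw, hG]; exact (hg q w hw0).ne'
  have hsq : ContDiffAt ℝ ∞ (fun u : E ↦ Real.sqrt (G u u)) (σ (f w)) :=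
    hquad.contDiffAt.sqrt hpos
  have hsqrt : ContMDiffAt 𝓘(ℝ, E) 𝓘(ℝ, ℝ) ∞ (fun u : E ↦ Real.sqrt (G u u)) (σ (f w)) :=
    hsq.contMDiffAt
  have h := hsqrt.comp (f w) hσs
  rw [show expMap g.leviCivita q w = f w from rfl]
  exact h.congr_of_eventuallyEq hkey


/-- **The distance from `q` is `C^∞` on `M ∖ ({q} ∪ Cut(q))`** (Petersen 2016, §5.7.3; Sakai
1996, Prop. III.4.8), for the metric cut locus `cutLocus g hg q` of `CutLocus.lean`
(`= exp_q(TCL(q))`, `cutLocus_eq_geodesicCutLocus`; its complement is `exp_q(ID(q))`,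
`lee_expMap_injectivityDomain_holds`). [cite: Petersen2016, §5.7.3]
[cite: LeeRiemannianManifolds2018, Thm. 10.34] -/
theorem contMDiffAt_edist_toReal_of_not_mem_cutLocus [ConnectedSpace M] (hg : g.IsRiemannian)
    (hc : IsGeodesicallyComplete g.leviCivita) {q z : M} (hz : z ∉ cutLocus g hg q) (hzq : z ≠ q) :
    ContMDiffAt 𝓘(ℝ, E) 𝓘(ℝ, ℝ) ∞ (fun z' ↦ (g.edist hg q z').toReal) z := by
  obtain ⟨-, -, himg, -, -⟩ := lee_expMap_injectivityDomain_holds le_rfl g hg hc q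
  rw [cutLocus_eq_geodesicCutLocus le_rfl hg hc q] at hz
  have hz' : z ∈ (geodesicCutLocus g hg q)ᶜ := hz
  rw [← himg] at hz'
  obtain ⟨w, hw, rfl⟩ := hz'
  have hw0 : w ≠ 0 := by
    rintro rfl
    exact hzq (expMap_zero (cov := g.leviCivita) q)
  exact contMDiffAt_edist_toReal_of_mem_injectivityDomain g hg hc q hw hw0

omit [FiniteDimensional ℝ E] [CompleteSpace E] [T2Space M] in
/-- From `C^∞` at a point to `C²` near the point. [folklore] -/
theorem eventually_contMDiffAt_two_of_contMDiffAt {F : M → ℝ} {x : M}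
    (hF : ContMDiffAt 𝓘(ℝ, E) 𝓘(ℝ, ℝ) ∞ F x) :
    ∀ᶠ x' in 𝓝 x, ContMDiffAt 𝓘(ℝ, E) 𝓘(ℝ, ℝ) 2 F x' := by
  have h2le : (2 : ℕ∞ω) ≤ (∞ : ℕ∞ω) := WithTop.coe_le_coe.2 le_top
  have h2 : ContMDiffAt 𝓘(ℝ, E) 𝓘(ℝ, ℝ) 2 F x := hF.of_le h2le
  obtain ⟨u, hu, hFu⟩ := (contMDiffAt_iff_contMDiffOn_nhds (by simp)).1 h2
  obtain ⟨v, hvu, hvo, hxv⟩ := mem_nhds_iff.1 hu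
  filter_upwards [hvo.mem_nhds hxv] with x' hx'
  exact (hFu.mono hvu).contMDiffAt (hvo.mem_nhds hx')

/-- **Classical Laplacian comparison off the cut locus, `Ric ≥ -(m-1) g`** (Calabi 1958;
Petersen 2016, Lemma 7.1.9): at `x = exp_q w`, `w ∈ ID(q) ∖ {0}` (where `d(q, ·)` is smooth),
`Δ d(q, ·)(x) ≤ (m - 1) coth d(q, x)`. [cite: Petersen2016, Lemma 7.1.9] [cite: Calabi1958] -/
theorem laplaceBeltrami_edist_le_coth_of_mem_injectivityDomain [ConnectedSpace M]
    [CovariantDerivative.ContMDiffCovariantDerivative g.leviCivita ∞] (hg : g.IsRiemannian)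
    (hc : IsGeodesicallyComplete g.leviCivita)
    (hRic : ∀ (x : M) (w : TangentSpace 𝓘(ℝ, E) x),
      -((Module.finrank ℝ E : ℝ) - 1) * g.val x w w ≤ g.leviCivita.ricci x w w)
    (q : M) {w : TangentSpace 𝓘(ℝ, E) q} (hw : w ∈ injectivityDomain g hg q) (hw0 : w ≠ 0) :
    g.laplaceBeltrami (fun z ↦ (g.edist hg q z).toReal) (expMap g.leviCivita q w) ≤
      ((Module.finrank ℝ E : ℝ) - 1) *
        (Real.cosh (g.edist hg q (expMap g.leviCivita q w)).toReal /
          Real.sinh (g.edist hg q (expMap g.leviCivita q w)).toReal) := by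
  have hxq : expMap g.leviCivita q w ≠ q := by
    intro h
    have h1 := edist_expMap_eq_of_mem_injectivityDomain g hg hc q hw
    rw [h, PseudoRiemannianMetric.edist_self] at h1
    have h2 : Real.sqrt (g.val q w w) = 0 := by
      have := ENNReal.ofReal_eq_zero.1 h1.symm
      exact le_antisymm this (Real.sqrt_nonneg _)
    rw [Real.sqrt_eq_zero'] at h2
    exact (not_le.2 (hg q w hw0)) h2
  exact laplaceBeltrami_le_coth_of_le_edist g hg hc hRic hxq
    (eventually_contMDiffAt_two_of_contMDiffAt
      (contMDiffAt_edist_toReal_of_mem_injectivityDomain g hg hc q hw hw0))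
    (Eventually.of_forall fun _ ↦ le_rfl) rfl

/-- **Classical Laplacian comparison off the cut locus, `Ric ≥ 0`**: at `x = exp_q w`,
`w ∈ ID(q) ∖ {0}`, `Δ d(q, ·)(x) ≤ (m - 1)/d(q, x)`. [cite: Petersen2016, Lemma 7.1.9]
[cite: Calabi1958] -/
theorem laplaceBeltrami_edist_le_div_of_mem_injectivityDomain [ConnectedSpace M]
    [CovariantDerivative.ContMDiffCovariantDerivative g.leviCivita ∞] (hg : g.IsRiemannian)
    (hc : IsGeodesicallyComplete g.leviCivita)
    (hRic : ∀ (x : M) (w : TangentSpace 𝓘(ℝ, E) x), 0 ≤ g.leviCivita.ricci x w w)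
    (q : M) {w : TangentSpace 𝓘(ℝ, E) q} (hw : w ∈ injectivityDomain g hg q) (hw0 : w ≠ 0) :
    g.laplaceBeltrami (fun z ↦ (g.edist hg q z).toReal) (expMap g.leviCivita q w) ≤
      ((Module.finrank ℝ E : ℝ) - 1) * (1 / (g.edist hg q (expMap g.leviCivita q w)).toReal) := by
  have hxq : expMap g.leviCivita q w ≠ q := by
    intro h
    have h1 := edist_expMap_eq_of_mem_injectivityDomain g hg hc q hw
    rw [h, PseudoRiemannianMetric.edist_self] at h1
    have h2 : Real.sqrt (g.val q w w) = 0 := by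
      have := ENNReal.ofReal_eq_zero.1 h1.symm
      exact le_antisymm this (Real.sqrt_nonneg _)
    rw [Real.sqrt_eq_zero'] at h2
    exact (not_le.2 (hg q w hw0)) h2
  exact laplaceBeltrami_le_div_of_le_edist g hg hc hRic hxq
    (eventually_contMDiffAt_two_of_contMDiffAt
      (contMDiffAt_edist_toReal_of_mem_injectivityDomain g hg hc q hw hw0))
    (Eventually.of_forall fun _ ↦ le_rfl) rfl

end Literature.Geometry.Riemannian

end
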